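import Literature.Analysis.FluidPDE.Tao2016AveragedNS.SelfSimilarCascadeResidues
import HarnessLib

/-!
# Quantitative floors for fronts of S-topology cascade lattices: Theorem A′ (trailing-energy floor),
# the lag-action lower bound, and Theorem B′-lag (weighted residue floor from lag data)

Cell theorems of harvest/h2-tao-ladder (theory-2 g10), PORTED onto the tree's profile-system vocabulary
`STable` / `IsSWave` / `sEnergy` / `sMass` / `sFlux` of `RenormalisedCascadeWaves.lean` and the scalar
cores and Theorems A/B/B′ of `SelfSimilarCascadeResidues.lean` (the kernel file of record is the cell's
`ThmA_quant.lean` v3.1, sha16 46d34f6681f7f677, Parts 4–6, 17 declarations, re-checked by the cell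
referee, cycle 32; Parts 0–3 of that file ARE the two tree modules just named). Port by p1 g9: the
namespace `TaoLadderCell` is replaced by the tree's `Literature.Analysis.FluidPDE.TaoCascade`, the proofs
are verbatim.

MODEL STATEMENTS ABOUT LATTICE ODEs (Tao 2016 §4: local cascade tables on the shift set `S`, in
travelling-wave / renormalised self-similar variables). Nothing in this file concerns the Navier–Stokes
equations. What these theorems do NOT give: anything about non-steady (non-profile) eternal solutions
(the cell's items 20451/20452), any `ε₀`-uniform statement beyond the explicit constants, anything on
the larger shift set `T`.

## Contents
* Part 4 — THEOREM A′ (`IsSWave.trailing_floor`, `IsSWave.residue_floor`, `IsSWave.residue_floor_explicit`):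
  for a bounded travelling / period-`q` front of the `λ = 1` lattice of ANY S-table (mass `≤ M`, lag
  `T`, trailing energy eventually `≤ L`, energy somewhere `> 2L`):
  `exp(−2 C_A M T − 1/4) ≤ 256 q (C_A T)² L` — an explicit floor on the energy a front must leave behind;
  scalar core `trailing_floor_of_wave_identity` (plateau / threshold / gap), and Theorem A recovered
  (`IsSWave.eq_zero_of_trailing_decay'`).
* Part 5 — LAG ACTION (`IsSWave.lag_action_lower_bound`): a nontrivial `λ = 1` front with leading decay
  has `2 C_A M T ≥ 1`.
* Part 6 — THEOREM B′-lag (`IsSWave.weighted_residue_floor`, scalar core `weighted_trailing_floor`): for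
  a renormalised exact front (`d > 0`, any `c₁, c₂`) with weighted energy `Ẽ = e^{2dx} E` eventually
  `≤ L`: either `Ẽ ≤ 3LΛ'` everywhere (`Λ' = e^{2|c₂| C_A M T}`) or at every phase `x⋆` with
  `Ẽ(x⋆) > 3LΛ'`, `d² ≤ 48 q (|c₁|e^{−2dT} + |c₂|)² C_A² Λ' · (L e^{−2dx⋆})`. (Not the tree's Theorem B′
  `IsSWave.weighted_sEnergy_le`, which needs `Integrable (sMass Φ)`; here the constants are lag data.)
-/

open Set MeasureTheory intervalIntegral Filter Topology
open scoped RealInnerProductSpace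

namespace Literature.Analysis.FluidPDE

namespace TaoCascade

/-! ## Part 4.  QUANTITATIVE THEOREM A′ (theory-2 g10): a trailing-energy FLOOR

Theorem A says: trailing energy `→ 0` forces `Φ ≡ 0`.  Part 4 makes this quantitative for the
same objects (bounded travelling / period-`q` waves of the `λ = 1` lattice of ANY S-table):
if the summed profile energy `E = sEnergy Φ` is eventually `≤ L` on the trailing side and the
wave somewhere exceeds `2L` (it IS a front, not a ripple on its own residue), then
`δ₀² ≤ 4 q L · exp(2 C_A (M + δ₀) T)` for every `δ₀ > 0` with `8 C_A T δ₀ ≤ 1`, where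
`q = card ρ` and `M ≥ sup sMass`.  With `δ₀ = 1/(8 C_A T)`:
`L ≥ exp(−2 C_A M T − 1/4) / (256 q C_A² T²)` — an explicit floor on the energy a front on an
S-table must leave behind per period, in terms of the table constant `C_A`, the lag `T`, the
number of profiles `q` and the mass bound `M` only (scale-covariant: `E ↦ κ²E, T ↦ T/κ`).
Mechanism: (1) PLATEAU — where the mass one lag ahead is `≤ δ₀`, the window identity
`E(S) − E(s) = 2(∫_S^{S+T} F − ∫_s^{s+T} F)` and `|F| ≤ C_A E G(·−T) ≤ C_A δ₀ E` give
`sup E ≤ L + ½ sup E` on the half-line, i.e. `E ≤ 2L`; (2) THRESHOLD — coming from `+∞`, the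
first phase `a` where `G` reaches `δ₀` has `G ≤ δ₀` on `[a, ∞)`, so the plateau holds on
`[a + T, ∞)`; (3) GAP — one backward comparison step over `[a, a+T]`
(`E' ≥ −2C_A(2L)δ₀ − 2 C_A M E`) gives `E(a) ≤ 4L e^{2C_A(M+δ₀)T}`; (4) `δ₀² ≤ G(a)² ≤ q E(a)`.
MODEL statement about lattice ODEs; nothing here concerns Navier–Stokes. -/

section QuantA

/-- Window identity (★): `e S − e s = 2 (∫_S^{S+T} f − ∫_s^{s+T} f)`.
[folklore] -/
private theorem window_identity {e f : ℝ → ℝ} {T : ℝ} (hf_cont : Continuous f)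
    (hderiv : ∀ s, HasDerivAt e (2 * (f (s + T) - f s)) s) (s S : ℝ) :
    e S - e s = 2 * ((∫ x in S..S + T, f x) - ∫ x in s..s + T, f x) := by
  have hfi : ∀ a b, IntervalIntegrable f MeasureTheory.volume a b :=
    fun a b => hf_cont.intervalIntegrable a b
  have hd : ∀ x ∈ uIcc s S, HasDerivAt e (2 * (f (x + T) - f x)) x := fun x _ => hderiv x
  have hcont' : Continuous fun x => 2 * (f (x + T) - f x) := by
    have : Continuous fun x => f (x + T) := hf_cont.comp (continuous_id.add continuous_const)
    exact continuous_const.mul (this.sub hf_cont)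
  have h1 := integral_eq_sub_of_hasDerivAt hd (hcont'.intervalIntegrable s S)
  have h2 : (∫ x in s..S, 2 * (f (x + T) - f x)) =
      2 * ((∫ x in s..S, f (x + T)) - ∫ x in s..S, f x) := by
    rw [intervalIntegral.integral_const_mul, intervalIntegral.integral_sub]
    · exact (hf_cont.comp (continuous_id.add continuous_const)).intervalIntegrable s S
    · exact hfi s S
  have h3 : (∫ x in s..S, f (x + T)) = ∫ x in s + T..S + T, f x :=
    intervalIntegral.integral_comp_add_right f T
  have h4 : (∫ x in s..S, f x) = (∫ x in s..s + T, f x) + ∫ x in s + T..S, f x :=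
    (integral_add_adjacent_intervals (hfi _ _) (hfi _ _)).symm
  have h5 : (∫ x in s + T..S + T, f x) = (∫ x in s + T..S, f x) + ∫ x in S..S + T, f x :=
    (integral_add_adjacent_intervals (hfi _ _) (hfi _ _)).symm
  rw [← h1, h2, h3, h4, h5]
  ring

/-- **Plateau lemma.**  If the mass one lag ahead is `≤ δ` on `[s₁ − T, ∞)` with `8 C T δ ≤ 1`,
`e` is bounded on `[s₁, ∞)` and drops to `≤ L` arbitrarily far out, then `e ≤ 2L` on `[s₁, ∞)`.
[cite: Tao2016AveragedNS, §4 Lemma 4.1 (4.8)–(4.9) with (4.3) (the lattice energy/flux structure the profile system abstracts); cell theorem of harvest/h2-tao-ladder (theory-2 g10, kernel file ThmA_quant.lean v3.1 46d34f6681f7f677, referee c32)] -/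
theorem plateau_of_small_mass {e f g : ℝ → ℝ} {T C δ L B s₁ : ℝ} (hT : 0 < T) (hC : 0 ≤ C)
    (hCTδ : 8 * C * T * δ ≤ 1) (hf_cont : Continuous f) (he_nn : ∀ s, 0 ≤ e s)
    (hg_nn : ∀ s, 0 ≤ g s) (hderiv : ∀ s, HasDerivAt e (2 * (f (s + T) - f s)) s)
    (hflux : ∀ σ, |f σ| ≤ C * e σ * g (σ - T))
    (hg : ∀ u, s₁ - T ≤ u → g u ≤ δ) (hB : ∀ s, s₁ ≤ s → e s ≤ B)
    (hfreq : ∀ S₀, ∃ S, S₀ ≤ S ∧ e S ≤ L) :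
    ∀ s, s₁ ≤ s → e s ≤ 2 * L := by
  -- window bound
  have hwin : ∀ K, (∀ s, s₁ ≤ s → e s ≤ K) → ∀ a, s₁ ≤ a →
      |∫ x in a..a + T, f x| ≤ C * δ * K * T := by
    intro K hK a ha
    have hK0 : 0 ≤ K := le_trans (he_nn s₁) (hK s₁ le_rfl)
    have hbound : ∀ x ∈ Set.uIoc a (a + T), ‖f x‖ ≤ C * δ * K := by
      intro x hx
      rw [uIoc_of_le (by linarith)] at hx
      have hex : e x ≤ K := hK x (by linarith [hx.1])
      have hgx : g (x - T) ≤ δ := hg (x - T) (by linarith [hx.1])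
      rw [Real.norm_eq_abs]
      calc |f x| ≤ C * e x * g (x - T) := hflux x
        _ ≤ C * K * δ := mul_le_mul (mul_le_mul_of_nonneg_left hex hC) hgx (hg_nn _)
            (mul_nonneg hC hK0)
        _ = C * δ * K := by ring
    have h := norm_integral_le_of_norm_le_const hbound
    rw [show a + T - a = T by ring, abs_of_pos hT, Real.norm_eq_abs] at h
    exact h
  -- one improvement step
  have hstep : ∀ K, (∀ s, s₁ ≤ s → e s ≤ K) → ∀ s, s₁ ≤ s → e s ≤ L + K / 2 := by
    intro K hK s hs
    have hK0 : 0 ≤ K := le_trans (he_nn s₁) (hK s₁ le_rfl)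
    obtain ⟨S, hSs, hSL⟩ := hfreq s
    have hid := window_identity hf_cont hderiv s S
    have h1 := abs_le.mp (hwin K hK S (le_trans hs hSs))
    have h2 := abs_le.mp (hwin K hK s hs)
    have h4 : 4 * (C * δ * K * T) ≤ K / 2 := by
      nlinarith [mul_nonneg hK0 (sub_nonneg.mpr hCTδ)]
    linarith [h1.1, h1.2, h2.1, h2.2]
  -- iterate
  have hB0 : 0 ≤ B := le_trans (he_nn s₁) (hB s₁ le_rfl)
  have hiter : ∀ n : ℕ, ∀ s, s₁ ≤ s → e s ≤ 2 * L + B / 2 ^ n := by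
    intro n
    induction n with
    | zero =>
      intro s hs
      have hL0 : 0 ≤ L := by obtain ⟨S, _, hSL⟩ := hfreq s₁; exact le_trans (he_nn S) hSL
      have := hB s hs
      simp only [pow_zero, div_one]
      linarith
    | succ n ih =>
      intro s hs
      have := hstep _ ih s hs
      have h2 : L + (2 * L + B / 2 ^ n) / 2 = 2 * L + B / 2 ^ (n + 1) := by
        rw [pow_succ]; ring
      linarith [h2]
  intro s hs
  refine le_of_forall_pos_le_add fun ε hε => ?_
  rcases eq_or_lt_of_le hB0 with hB' | hBpos
  · have := hiter 0 s hs
    rw [← hB'] at this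
    simp only [pow_zero, div_one, add_zero] at this
    linarith
  · obtain ⟨n, hn⟩ := exists_pow_lt_of_lt_one (div_pos hε hBpos) (by norm_num : (1:ℝ) / 2 < 1)
    have h1 : B / 2 ^ n = B * (1 / 2) ^ n := by
      rw [one_div, inv_pow, div_eq_mul_inv]
    have h2 : B * (1 / 2) ^ n < ε := by
      have := (lt_div_iff₀ hBpos).mp hn
      linarith [this]
    have := hiter n s hs
    rw [h1] at this
    linarith

/-- **Gap lemma** (one backward comparison step over a lag).  If `g ≤ δ` on `[a, ∞)`, `g ≤ M`
everywhere and `e ≤ Ep` on `[a + T, ∞)`, then `e ≤ 2 Ep exp(2 C (M + δ) T)` on `[a, a + T]`.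
[cite: Tao2016AveragedNS, §4 Lemma 4.1 (4.8)–(4.9) with (4.3) (the lattice energy/flux structure the profile system abstracts); cell theorem of harvest/h2-tao-ladder (theory-2 g10, kernel file ThmA_quant.lean v3.1 46d34f6681f7f677, referee c32)] -/
theorem gap_bound {e f g : ℝ → ℝ} {T C δ M Ep a : ℝ} (hT : 0 < T) (hC : 0 ≤ C) (hδ : 0 ≤ δ)
    (hM : 0 ≤ M) (hE : 0 ≤ Ep) (he_cont : Continuous e) (he_nn : ∀ s, 0 ≤ e s)
    (hg_nn : ∀ s, 0 ≤ g s) (hderiv : ∀ s, HasDerivAt e (2 * (f (s + T) - f s)) s)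
    (hflux : ∀ σ, |f σ| ≤ C * e σ * g (σ - T))
    (hg : ∀ u, a ≤ u → g u ≤ δ) (hgM : ∀ u, g u ≤ M) (hplat : ∀ s, a + T ≤ s → e s ≤ Ep) :
    ∀ u, a ≤ u → u ≤ a + T → e u ≤ 2 * Ep * Real.exp (2 * C * (M + δ) * T) := by
  intro u hau huT
  have _hT := hT
  set m := M + δ with hm
  have hm0 : 0 ≤ m := by rw [hm]; positivity
  set ψ : ℝ → ℝ := fun x => (e x + Ep) * Real.exp (2 * C * m * x) with hψ
  have hderivψ : ∀ x, HasDerivAt ψ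
      ((2 * (f (x + T) - f x)) * Real.exp (2 * C * m * x)
        + (e x + Ep) * (Real.exp (2 * C * m * x) * (2 * C * m))) x := by
    intro x
    have h1 : HasDerivAt (fun x => e x + Ep) (2 * (f (x + T) - f x)) x :=
      (hderiv x).add_const Ep
    have h2 : HasDerivAt (fun x => Real.exp (2 * C * m * x))
        (Real.exp (2 * C * m * x) * (2 * C * m)) x := by
      have : HasDerivAt (fun x => 2 * C * m * x) (2 * C * m) x := by
        simpa using (hasDerivAt_id x).const_mul (2 * C * m)
      simpa using this.exp
    exact h1.mul h2
  have hnonneg : ∀ x, a ≤ x → x ≤ a + T →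
      0 ≤ (2 * (f (x + T) - f x)) * Real.exp (2 * C * m * x)
        + (e x + Ep) * (Real.exp (2 * C * m * x) * (2 * C * m)) := by
    intro x hax _hxT
    have hex := Real.exp_pos (2 * C * m * x)
    have hf1 : |f (x + T)| ≤ C * Ep * δ := by
      calc |f (x + T)| ≤ C * e (x + T) * g (x + T - T) := hflux (x + T)
        _ = C * e (x + T) * g x := by rw [add_sub_cancel_right]
        _ ≤ C * Ep * δ :=
            mul_le_mul (mul_le_mul_of_nonneg_left (hplat (x + T) (by linarith)) hC) (hg x hax)
              (hg_nn x) (mul_nonneg hC hE)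
    have hf2 : |f x| ≤ C * e x * M := by
      calc |f x| ≤ C * e x * g (x - T) := hflux x
        _ ≤ C * e x * M := mul_le_mul_of_nonneg_left (hgM _) (mul_nonneg hC (he_nn x))
    have hf1' := abs_le.mp hf1
    have hf2' := abs_le.mp hf2
    have hm1 : C * Ep * δ ≤ C * m * Ep := by
      have : δ ≤ m := by rw [hm]; linarith
      nlinarith [mul_nonneg hC hE]
    have hm2 : C * e x * M ≤ C * m * e x := by
      have : M ≤ m := by rw [hm]; linarith
      nlinarith [mul_nonneg hC (he_nn x)]
    have key : -(2 * C * m * (e x + Ep)) ≤ 2 * (f (x + T) - f x) := by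
      linarith [hf1'.1, hf2'.2]
    have h := mul_le_mul_of_nonneg_right key hex.le
    have hid : (e x + Ep) * (Real.exp (2 * C * m * x) * (2 * C * m))
        = 2 * C * m * (e x + Ep) * Real.exp (2 * C * m * x) := by ring
    rw [hid]
    linarith
  have hcontψ : Continuous ψ := by
    have h1 : Continuous fun x => Real.exp (2 * C * m * x) :=
      Real.continuous_exp.comp (continuous_const.mul continuous_id)
    exact (he_cont.add continuous_const).mul h1
  have hmono : MonotoneOn ψ (Icc a (a + T)) :=
    monotoneOn_of_hasDerivWithinAt_nonneg (convex_Icc a (a + T)) hcontψ.continuousOn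
      (fun x _ => (hderivψ x).hasDerivWithinAt)
      (fun x hx => by
        rw [interior_Icc] at hx
        exact hnonneg x hx.1.le hx.2.le)
  have hψle : ψ u ≤ ψ (a + T) := hmono ⟨hau, huT⟩ ⟨by linarith, le_rfl⟩ huT
  have hsplit : Real.exp (2 * C * m * (a + T))
      = Real.exp (2 * C * m * u) * Real.exp (2 * C * m * (a + T - u)) := by
    rw [← Real.exp_add]; congr 1; ring
  have hpos := Real.exp_pos (2 * C * m * u)
  have hψ' : (e u + Ep) * Real.exp (2 * C * m * u)
      ≤ (2 * Ep * Real.exp (2 * C * m * (a + T - u))) * Real.exp (2 * C * m * u) := by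
    calc (e u + Ep) * Real.exp (2 * C * m * u) = ψ u := rfl
      _ ≤ ψ (a + T) := hψle
      _ = (e (a + T) + Ep) * Real.exp (2 * C * m * (a + T)) := rfl
      _ ≤ (2 * Ep) * Real.exp (2 * C * m * (a + T)) :=
          mul_le_mul_of_nonneg_right (by linarith [hplat (a + T) le_rfl]) (Real.exp_pos _).le
      _ = (2 * Ep * Real.exp (2 * C * m * (a + T - u))) * Real.exp (2 * C * m * u) := by
          rw [hsplit]; ring
  have h3 : e u + Ep ≤ 2 * Ep * Real.exp (2 * C * m * (a + T - u)) :=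
    le_of_mul_le_mul_right hψ' hpos
  have hexp_le : Real.exp (2 * C * m * (a + T - u)) ≤ Real.exp (2 * C * m * T) := by
    apply Real.exp_le_exp.mpr
    have : a + T - u ≤ T := by linarith
    exact mul_le_mul_of_nonneg_left this (by positivity)
  have h4 : 2 * Ep * Real.exp (2 * C * m * (a + T - u)) ≤ 2 * Ep * Real.exp (2 * C * m * T) :=
    mul_le_mul_of_nonneg_left hexp_le (by positivity)
  linarith [h3, h4, hE]

/-- **Threshold point.**  For continuous `g` with `g ≤ δ₀` on a half-line: either `g ≤ δ₀`
everywhere, or there is a phase `a` with `g ≤ δ₀` on `[a, ∞)` and `δ₀ ≤ g a`.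
[folklore] -/
private theorem threshold_point {g : ℝ → ℝ} (hg : Continuous g) {δ₀ a₀ : ℝ}
    (h : ∀ u, a₀ ≤ u → g u ≤ δ₀) :
    (∀ u, g u ≤ δ₀) ∨ ∃ a, (∀ u, a ≤ u → g u ≤ δ₀) ∧ δ₀ ≤ g a := by
  set A : Set ℝ := {a | ∀ u, a ≤ u → g u ≤ δ₀} with hA
  have hne : A.Nonempty := ⟨a₀, h⟩
  have hArepr : A = ⋂ u : ℝ, (fun a => g (max a u)) ⁻¹' Iic δ₀ := by
    ext a
    simp only [hA, Set.mem_setOf_eq, Set.mem_iInter, Set.mem_preimage, Set.mem_Iic]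
    constructor
    · intro ha u
      exact ha (max a u) (le_max_left _ _)
    · intro ha u hu
      have := ha u
      rwa [max_eq_right hu] at this
  have hclosed : IsClosed A := by
    rw [hArepr]
    exact isClosed_iInter fun u =>
      isClosed_Iic.preimage (hg.comp (continuous_id.max continuous_const))
  by_cases hbdd : BddBelow A
  · right
    have hmem : sInf A ∈ A := hclosed.csInf_mem hne hbdd
    refine ⟨sInf A, hmem, ?_⟩
    by_contra hlt
    push Not at hlt
    obtain ⟨η, hη, hη'⟩ := Metric.continuous_iff.mp hg (sInf A) (δ₀ - g (sInf A)) (by linarith)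
    have hball : ∀ x, dist x (sInf A) < η → g x < δ₀ := by
      intro x hx
      have := hη' x hx
      rw [Real.dist_eq] at this
      have := (abs_lt.mp this).2
      linarith
    have hmem' : sInf A - η / 2 ∈ A := by
      intro u hu
      by_cases hu' : sInf A ≤ u
      · exact hmem u hu'
      · push Not at hu'
        have : dist u (sInf A) < η := by
          rw [Real.dist_eq, abs_lt]; constructor <;> linarith
        exact (hball u this).le
    have := csInf_le hbdd hmem'
    linarith
  · left
    intro u
    rw [bddBelow_def] at hbdd
    push Not at hbdd
    obtain ⟨a, haA, hau⟩ := hbdd u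
    exact haA u hau.le

/-- **THEOREM A′ — scalar core (quantitative trailing floor).**  See the Part 4 docstring.
[cite: Tao2016AveragedNS, §4 Lemma 4.1 (4.8)–(4.9) with (4.3) (the lattice energy/flux structure the profile system abstracts); cell theorem of harvest/h2-tao-ladder (theory-2 g10, kernel file ThmA_quant.lean v3.1 46d34f6681f7f677, referee c32)] -/
theorem trailing_floor_of_wave_identity
    {e f g : ℝ → ℝ} {T C q M L δ₀ : ℝ} (hT : 0 < T) (hC : 0 ≤ C) (hq : 0 ≤ q) (hM : 0 ≤ M)
    (hL : 0 ≤ L) (hδ₀ : 0 < δ₀) (hCTδ : 8 * C * T * δ₀ ≤ 1)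
    (he_cont : Continuous e) (hf_cont : Continuous f) (hg_cont : Continuous g)
    (he_nn : ∀ s, 0 ≤ e s) (hg_nn : ∀ s, 0 ≤ g s)
    (hderiv : ∀ s, HasDerivAt e (2 * (f (s + T) - f s)) s)
    (hflux : ∀ σ, |f σ| ≤ C * e σ * g (σ - T))
    (hge : ∀ s, g s ^ 2 ≤ q * e s) (hgM : ∀ s, g s ≤ M)
    (hev : ∃ S₀, ∀ S, S₀ ≤ S → e S ≤ L) :
    (∀ s, e s ≤ 2 * L) ∨ δ₀ ^ 2 ≤ 4 * q * L * Real.exp (2 * C * (M + δ₀) * T) := by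
  obtain ⟨S₀, hS₀⟩ := hev
  have hfreq : ∀ S₁, ∃ S, S₁ ≤ S ∧ e S ≤ L :=
    fun S₁ => ⟨max S₁ S₀, le_max_left _ _, hS₀ _ (le_max_right _ _)⟩
  have hbd : ∀ s₁, ∃ B, ∀ s, s₁ ≤ s → e s ≤ B := by
    intro s₁
    obtain ⟨x₀, _, hx₀⟩ := (isCompact_Icc (a := s₁) (b := max s₁ S₀)).exists_isMaxOn
      (nonempty_Icc.mpr (le_max_left _ _)) he_cont.continuousOn
    refine ⟨max (e x₀) L, fun s hs => ?_⟩
    by_cases h : s ≤ max s₁ S₀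
    · exact le_trans (hx₀ ⟨hs, h⟩) (le_max_left _ _)
    · push Not at h
      exact le_trans (hS₀ s (le_trans (le_max_right _ _) h.le)) (le_max_right _ _)
  by_cases hcase : δ₀ ^ 2 ≤ q * L
  · right
    have hexp : 1 ≤ Real.exp (2 * C * (M + δ₀) * T) := Real.one_le_exp (by positivity)
    nlinarith [hexp, mul_nonneg hq hL]
  push Not at hcase
  have hgev : ∀ u, S₀ ≤ u → g u ≤ δ₀ := by
    intro u hu
    have h1 : g u ^ 2 ≤ q * L := le_trans (hge u) (mul_le_mul_of_nonneg_left (hS₀ u hu) hq)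
    by_contra hnot
    push Not at hnot
    have : δ₀ ^ 2 < g u ^ 2 := by nlinarith [hnot, hδ₀]
    linarith
  rcases threshold_point hg_cont hgev with hall | ⟨a, ha, hga⟩
  · left
    intro s
    obtain ⟨B, hB⟩ := hbd s
    exact plateau_of_small_mass hT hC hCTδ hf_cont he_nn hg_nn hderiv hflux
      (fun u _ => hall u) hB hfreq s le_rfl
  · right
    obtain ⟨B, hB⟩ := hbd (a + T)
    have hplat : ∀ s, a + T ≤ s → e s ≤ 2 * L :=
      plateau_of_small_mass hT hC hCTδ hf_cont he_nn hg_nn hderiv hflux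
        (fun u hu => ha u (by linarith)) hB hfreq
    have hgap := gap_bound hT hC hδ₀.le hM (by positivity : (0:ℝ) ≤ 2 * L) he_cont he_nn
      hg_nn hderiv hflux ha hgM hplat a le_rfl (by linarith)
    have h1 : δ₀ ^ 2 ≤ g a ^ 2 := by nlinarith [hga, hδ₀]
    have h2 := hge a
    have h3 : q * e a ≤ q * (2 * (2 * L) * Real.exp (2 * C * (M + δ₀) * T)) :=
      mul_le_mul_of_nonneg_left hgap hq
    linarith

end QuantA

section QuantAProfiles

variable {V : Type*} [NormedAddCommGroup V] [InnerProductSpace ℝ V]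
variable {ρ : Type*} [Fintype ρ]

omit [InnerProductSpace ℝ V] in
/-- `sMass² ≤ q · sEnergy` (Cauchy–Schwarz), `q = card ρ`.
[folklore] -/
private theorem sMass_sq_le (Φ : ρ → ℝ → V) (x : ℝ) :
    sMass Φ x ^ 2 ≤ (Fintype.card ρ : ℝ) * sEnergy Φ x := by
  unfold sMass sEnergy
  have := sq_sum_le_card_mul_sum_sq (s := Finset.univ) (f := fun r => ‖Φ r x‖)
  simpa using this

/-- **THEOREM A′ (quantitative Theorem A; general S-table, period-`q`, `λ = 1`).**
Let `Φ` be a profile family of the uniform lattice of an S-topology table with mass bound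
`sMass Φ ≤ M` and trailing energy eventually `≤ L`.  For every `δ₀ > 0` with `8 C_A T δ₀ ≤ 1`:
either `sEnergy Φ ≤ 2L` everywhere (no front), or `δ₀² ≤ 4 q L exp(2 C_A (M + δ₀) T)`.
(Model statement about lattice ODEs; nothing here is a claim about Navier–Stokes.)
[cite: Tao2016AveragedNS, §4 Lemma 4.1 (4.8)–(4.9) with (4.3) (the lattice energy/flux structure the profile system abstracts); cell theorem of harvest/h2-tao-ladder (theory-2 g10, kernel file ThmA_quant.lean v3.1 46d34f6681f7f677, referee c32)] -/
theorem IsSWave.trailing_floor {π : Equiv.Perm ρ} {Q A : V → V} {B : V → V → V}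
    {CA T : ℝ} (hS : STable Q A B CA) (hT : 0 < T) {Φ : ρ → ℝ → V}
    (hΦ : IsSWave π Q A B 0 1 1 T Φ) {M L δ₀ : ℝ} (hM : ∀ x, sMass Φ x ≤ M) (hL : 0 ≤ L)
    (hev : ∃ S₀, ∀ x, S₀ ≤ x → sEnergy Φ x ≤ L) (hδ₀ : 0 < δ₀)
    (hCTδ : 8 * CA * T * δ₀ ≤ 1) :
    (∀ x, sEnergy Φ x ≤ 2 * L) ∨
      δ₀ ^ 2 ≤ 4 * (Fintype.card ρ : ℝ) * L * Real.exp (2 * CA * (M + δ₀) * T) := by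
  have hM0 : 0 ≤ M := le_trans (sMass_nonneg Φ 0) (hM 0)
  have hderiv : ∀ x, HasDerivAt (sEnergy Φ)
      (2 * (sFlux π A T Φ (x + T) - sFlux π A T Φ x)) x := by
    intro x
    refine (hasDerivAt_sEnergy hS hΦ x).congr_deriv ?_
    ring
  have hflux : ∀ σ, |sFlux π A T Φ σ| ≤ CA * sEnergy Φ σ * sMass Φ (σ - T) :=
    fun σ => abs_sFlux_le hS π T Φ σ
  exact trailing_floor_of_wave_identity hT hS.CA_nonneg (Nat.cast_nonneg _) hM0 hL hδ₀ hCTδ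
    hΦ.continuous_sEnergy (hΦ.continuous_sFlux hS) hΦ.continuous_sMass (sEnergy_nonneg Φ)
    (sMass_nonneg Φ) hderiv hflux (sMass_sq_le Φ) hM hev

/-- **Residue floor** (contrapositive reading of A′).  A front on an S-table — a profile family
whose energy somewhere exceeds twice its eventual trailing level `L` — has
`L ≥ δ₀² exp(−2 C_A (M + δ₀) T) / (4q)` for every admissible `δ₀`.
[cite: Tao2016AveragedNS, §4 Lemma 4.1 (4.8)–(4.9) with (4.3) (the lattice energy/flux structure the profile system abstracts); cell theorem of harvest/h2-tao-ladder (theory-2 g10, kernel file ThmA_quant.lean v3.1 46d34f6681f7f677, referee c32)] -/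
theorem IsSWave.residue_floor {π : Equiv.Perm ρ} {Q A : V → V} {B : V → V → V}
    {CA T : ℝ} (hS : STable Q A B CA) (hT : 0 < T) {Φ : ρ → ℝ → V}
    (hΦ : IsSWave π Q A B 0 1 1 T Φ) {M L δ₀ : ℝ} (hM : ∀ x, sMass Φ x ≤ M) (hL : 0 ≤ L)
    (hev : ∃ S₀, ∀ x, S₀ ≤ x → sEnergy Φ x ≤ L) (hδ₀ : 0 < δ₀)
    (hCTδ : 8 * CA * T * δ₀ ≤ 1) (hfront : ∃ x, 2 * L < sEnergy Φ x) :
    δ₀ ^ 2 * Real.exp (-(2 * CA * (M + δ₀) * T)) / (4 * Fintype.card ρ) ≤ L := by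
  obtain ⟨x, hx⟩ := hfront
  rcases hΦ.trailing_floor hS hT hM hL hev hδ₀ hCTδ with h | h
  · exact absurd (h x) (not_le.mpr hx)
  · have hq : (0 : ℝ) ≤ Fintype.card ρ := Nat.cast_nonneg _
    rcases eq_or_lt_of_le hq with hq0 | hqpos
    · rw [← hq0] at h ⊢
      have : δ₀ ^ 2 ≤ 0 := by simpa using h
      nlinarith [hδ₀]
    · have hE := Real.exp_pos (-(2 * CA * (M + δ₀) * T))
      have hEE : Real.exp (-(2 * CA * (M + δ₀) * T)) * Real.exp (2 * CA * (M + δ₀) * T) = 1 := by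
        rw [← Real.exp_add]; simp
      rw [div_le_iff₀ (by positivity)]
      have := mul_le_mul_of_nonneg_right h hE.le
      calc δ₀ ^ 2 * Real.exp (-(2 * CA * (M + δ₀) * T))
          ≤ 4 * (Fintype.card ρ : ℝ) * L * Real.exp (2 * CA * (M + δ₀) * T)
              * Real.exp (-(2 * CA * (M + δ₀) * T)) := this
        _ = L * (4 * Fintype.card ρ) := by
            rw [mul_assoc (4 * (Fintype.card ρ : ℝ) * L), mul_comm (Real.exp _), hEE]; ring

/-- Consistency: THEOREM A follows from A′ (trailing decay ⇒ every `L > 0` is an eventual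
bound, the second alternative fails for small `L`, so `sEnergy ≤ 2L` for all `L > 0`).
[cite: Tao2016AveragedNS, §4 Lemma 4.1 (4.8)–(4.9) with (4.3) (the lattice energy/flux structure the profile system abstracts); cell theorem of harvest/h2-tao-ladder (theory-2 g10, kernel file ThmA_quant.lean v3.1 46d34f6681f7f677, referee c32)] -/
theorem IsSWave.eq_zero_of_trailing_decay' {π : Equiv.Perm ρ} {Q A : V → V} {B : V → V → V}
    {CA T : ℝ} (hS : STable Q A B CA) (hT : 0 < T) {Φ : ρ → ℝ → V}
    (hΦ : IsSWave π Q A B 0 1 1 T Φ) {M : ℝ} (hM : ∀ x, sMass Φ x ≤ M)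
    (decay : Tendsto (sEnergy Φ) atTop (𝓝 0)) : ∀ r x, Φ r x = 0 := by
  have hM0 : 0 ≤ M := le_trans (sMass_nonneg Φ 0) (hM 0)
  -- an admissible δ₀
  set δ₀ : ℝ := 1 / (8 * CA * T + 1) with hδ₀def
  have hCA := hS.CA_nonneg
  have hδ₀ : 0 < δ₀ := by rw [hδ₀def]; positivity
  have hCTδ : 8 * CA * T * δ₀ ≤ 1 := by
    rw [hδ₀def, show 8 * CA * T * (1 / (8 * CA * T + 1)) = (8 * CA * T) / (8 * CA * T + 1) by
      field_simp]
    rw [div_le_iff₀ (by positivity)]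
    linarith
  set K : ℝ := 4 * (Fintype.card ρ : ℝ) * Real.exp (2 * CA * (M + δ₀) * T) with hK
  have hK0 : 0 ≤ K := by rw [hK]; positivity
  have hsmall : ∀ x, ∀ L, 0 < L → L * K < δ₀ ^ 2 → sEnergy Φ x ≤ 2 * L := by
    intro x L hLpos hLK
    have hev : ∃ S₀, ∀ y, S₀ ≤ y → sEnergy Φ y ≤ L := by
      obtain ⟨N, hN⟩ := (Metric.tendsto_atTop.mp decay) L hLpos
      refine ⟨N, fun y hy => ?_⟩
      have := hN y hy
      rw [dist_zero_right, Real.norm_eq_abs, abs_of_nonneg (sEnergy_nonneg Φ y)] at this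
      exact this.le
    rcases hΦ.trailing_floor hS hT hM hLpos.le hev hδ₀ hCTδ with h | h
    · exact h x
    · exfalso
      have : 4 * (Fintype.card ρ : ℝ) * L * Real.exp (2 * CA * (M + δ₀) * T) = L * K := by
        rw [hK]; ring
      linarith
  have hzero : ∀ x, sEnergy Φ x = 0 := by
    intro x
    refine le_antisymm ?_ (sEnergy_nonneg Φ x)
    refine le_of_forall_pos_le_add fun ε hε => ?_
    -- choose L with 2L ≤ ε and L K < δ₀²
    set L : ℝ := min (ε / 2) (δ₀ ^ 2 / (2 * (K + 1))) with hLdef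
    have hLpos : 0 < L := by rw [hLdef]; positivity
    have hL1 : L ≤ ε / 2 := min_le_left _ _
    have hL2 : L * K < δ₀ ^ 2 := by
      have hL2' : L ≤ δ₀ ^ 2 / (2 * (K + 1)) := min_le_right _ _
      have : δ₀ ^ 2 / (2 * (K + 1)) * K < δ₀ ^ 2 := by
        rw [div_mul_eq_mul_div, div_lt_iff₀ (by positivity)]
        nlinarith [hδ₀, hK0]
      nlinarith [hL2', hK0]
    have := hsmall x L hLpos hL2
    linarith
  intro r x
  exact eq_zero_of_sEnergy_eq_zero (hzero x) r

omit [InnerProductSpace ℝ V] in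
/-- `sEnergy ≤ sMass²` (termwise: `a_r² ≤ a_r · Σ a`).
[folklore] -/
private theorem sEnergy_le_sMass_sq (Φ : ρ → ℝ → V) (x : ℝ) : sEnergy Φ x ≤ sMass Φ x ^ 2 := by
  unfold sEnergy sMass
  have hle : ∀ r ∈ (Finset.univ : Finset ρ),
      ‖Φ r x‖ ^ 2 ≤ ‖Φ r x‖ * ∑ r', ‖Φ r' x‖ := by
    intro r _
    rw [sq]
    exact mul_le_mul_of_nonneg_left
      (Finset.single_le_sum (fun i _ => norm_nonneg (Φ i x)) (Finset.mem_univ r)) (norm_nonneg _)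
  calc ∑ r, ‖Φ r x‖ ^ 2 ≤ ∑ r, ‖Φ r x‖ * ∑ r', ‖Φ r' x‖ := Finset.sum_le_sum hle
    _ = (∑ r, ‖Φ r x‖) ^ 2 := by rw [← Finset.sum_mul]; ring

/-- **Residue floor, explicit** (`δ₀ = 1/(8 C_A T)`, `C_A > 0`): a front on an S-table has
trailing level `L ≥ exp(−2 C_A M T − 1/4) / (256 q (C_A T)²)`.  With `sEnergy ≤ sMass² ≤ M²`
this is the RELATIVE floor `L / sup sEnergy ≥ exp(−2a − 1/4) / (256 q a²)`, `a := C_A M T`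
(the "lag action" of the front) — the only dimensionless quantity the floor depends on.
[cite: Tao2016AveragedNS, §4 Lemma 4.1 (4.8)–(4.9) with (4.3) (the lattice energy/flux structure the profile system abstracts); cell theorem of harvest/h2-tao-ladder (theory-2 g10, kernel file ThmA_quant.lean v3.1 46d34f6681f7f677, referee c32)] -/
theorem IsSWave.residue_floor_explicit {π : Equiv.Perm ρ} {Q A : V → V} {B : V → V → V}
    {CA T : ℝ} (hS : STable Q A B CA) (hT : 0 < T) (hCA : 0 < CA) {Φ : ρ → ℝ → V}
    (hΦ : IsSWave π Q A B 0 1 1 T Φ) {M L : ℝ} (hM : ∀ x, sMass Φ x ≤ M) (hL : 0 ≤ L)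
    (hev : ∃ S₀, ∀ x, S₀ ≤ x → sEnergy Φ x ≤ L) (hfront : ∃ x, 2 * L < sEnergy Φ x) :
    Real.exp (-(2 * CA * M * T) - 1 / 4) ≤ 256 * (Fintype.card ρ : ℝ) * (CA * T) ^ 2 * L := by
  have hq0 : 0 < (Fintype.card ρ : ℝ) := by
    obtain ⟨x, hx⟩ := hfront
    rcases Nat.eq_zero_or_pos (Fintype.card ρ) with h0 | hpos
    · haveI := Fintype.card_eq_zero_iff.mp h0
      have : sEnergy Φ x = 0 := by simp [sEnergy]
      linarith
    · exact_mod_cast hpos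
  have hδ₀ : 0 < 1 / (8 * CA * T) := by positivity
  have hCTδ : 8 * CA * T * (1 / (8 * CA * T)) ≤ 1 := by
    rw [mul_one_div_cancel (by positivity)]
  have h := hΦ.residue_floor hS hT hM hL hev hδ₀ hCTδ hfront
  have hexp : -(2 * CA * (M + 1 / (8 * CA * T)) * T) = -(2 * CA * M * T) - 1 / 4 := by
    field_simp; ring
  rw [hexp, div_le_iff₀ (by positivity)] at h
  have h2 := mul_le_mul_of_nonneg_right h (by positivity : (0:ℝ) ≤ 64 * (CA * T) ^ 2)
  have hid : (1 / (8 * CA * T)) ^ 2 * Real.exp (-(2 * CA * M * T) - 1 / 4) * (64 * (CA * T) ^ 2)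
      = Real.exp (-(2 * CA * M * T) - 1 / 4) := by
    field_simp; ring
  rw [hid] at h2
  calc Real.exp (-(2 * CA * M * T) - 1 / 4)
      ≤ L * (4 * (Fintype.card ρ : ℝ)) * (64 * (CA * T) ^ 2) := h2
    _ = 256 * (Fintype.card ρ : ℝ) * (CA * T) ^ 2 * L := by ring

end QuantAProfiles

/-! ## Part 5.  The lag action is bounded BELOW: `2 C_A M T ≥ 1` for every front (theory-2 g10)

Complement to A′: the floor `exp(−2a − 1/4)/(256 q a²)` degrades only for LARGE lag action
`a = C_A M T`; small `a` is impossible — a nontrivial wave with LEADING decay (`Φ_r → 0` at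
`−∞`: the shell is empty before the front arrives) has `a ≥ 1/2`, because by the window
identity `E(s) = 2 ∫_s^{s+T} F ≤ 2 C_A T M · sup E`.  At `a = 1/2` the A′ floor is
`e^{−5/4}/(64 q) ≈ 4.5·10⁻³/q`.  MODEL statement; nothing about Navier–Stokes. -/

section LagAction

/-- Scalar core: identity `e' = 2(f(·+T) − f)`, flux bound `|f| ≤ C e g(·−T)`, `g ≤ M`,
`e` bounded, `e, f → 0` at `−∞`, `e ≢ 0` ⇒ `1 ≤ 2 C M T`.
[cite: Tao2016AveragedNS, §4 Lemma 4.1 (4.8)–(4.9) with (4.3) (the lattice energy/flux structure the profile system abstracts); cell theorem of harvest/h2-tao-ladder (theory-2 g10, kernel file ThmA_quant.lean v3.1 46d34f6681f7f677, referee c32)] -/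
theorem lag_action_lower_bound_of_wave_identity {e f g : ℝ → ℝ} {T C M B : ℝ}
    (hT : 0 < T) (hC : 0 ≤ C) (hM : 0 ≤ M) (hf_cont : Continuous f)
    (he_nn : ∀ s, 0 ≤ e s) (hg_nn : ∀ s, 0 ≤ g s)
    (hderiv : ∀ s, HasDerivAt e (2 * (f (s + T) - f s)) s)
    (hflux : ∀ σ, |f σ| ≤ C * e σ * g (σ - T)) (hgM : ∀ s, g s ≤ M) (heB : ∀ s, e s ≤ B)
    (he_bot : Tendsto e atBot (𝓝 0)) (hf_bot : Tendsto f atBot (𝓝 0))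
    (hpos : ∃ s, 0 < e s) : 1 ≤ 2 * C * M * T := by
  set I : ℝ → ℝ := fun a => ∫ x in a..a + T, f x with hI
  -- I S → 0 as S → −∞ (via y ↦ −y and `atTop`)
  have hf_bot' : Tendsto (fun y => f (-y)) atTop (𝓝 0) := hf_bot.comp tendsto_neg_atTop_atBot
  have hI_top : Tendsto (fun y => I (-y)) atTop (𝓝 0) := by
    rw [Metric.tendsto_atTop]
    intro ε hε
    have hε' : 0 < ε / (2 * T) := by positivity
    obtain ⟨R, hR⟩ := (Metric.tendsto_atTop.mp hf_bot') (ε / (2 * T)) hε'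
    refine ⟨R + T, fun y hy => ?_⟩
    have hbound : ∀ x ∈ Set.uIoc (-y) (-y + T), ‖f x‖ ≤ ε / (2 * T) := by
      intro x hx
      rw [uIoc_of_le (by linarith)] at hx
      have := hR (-x) (by linarith [hx.2])
      rw [dist_zero_right, neg_neg] at this
      exact this.le
    have := norm_integral_le_of_norm_le_const hbound
    rw [dist_zero_right]
    calc ‖I (-y)‖ ≤ ε / (2 * T) * |(-y) + T - (-y)| := this
      _ = ε / 2 := by rw [show (-y) + T - (-y) = T by ring, abs_of_pos hT]; field_simp
      _ < ε := by linarith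
  have hI_bot : Tendsto I atBot (𝓝 0) := by
    have := hI_top.comp tendsto_neg_atBot_atTop
    simpa [Function.comp_def, neg_neg] using this
  -- e s = 2 I s
  have e_eq : ∀ s, e s = 2 * I s := by
    intro s
    have h1 : Tendsto (fun S => e S + 2 * (I s - I S)) atBot (𝓝 (0 + 2 * (I s - 0))) :=
      he_bot.add ((tendsto_const_nhds.sub hI_bot).const_mul 2)
    have h2 : (fun S => e S + 2 * (I s - I S)) = fun _ => e s := by
      funext S
      have := window_identity hf_cont hderiv S s
      linarith
    rw [h2] at h1
    have := tendsto_nhds_unique tendsto_const_nhds h1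
    linarith
  -- one contraction step: e ≤ K ⇒ e ≤ (2 C M T) K
  have hstep : ∀ K, (∀ s, e s ≤ K) → ∀ s, e s ≤ (2 * C * M * T) * K := by
    intro K hK s
    have hK0 : 0 ≤ K := le_trans (he_nn s) (hK s)
    have hbound : ∀ x ∈ Set.uIoc s (s + T), ‖f x‖ ≤ C * K * M := by
      intro x _
      rw [Real.norm_eq_abs]
      calc |f x| ≤ C * e x * g (x - T) := hflux x
        _ ≤ C * K * M := mul_le_mul (mul_le_mul_of_nonneg_left (hK x) hC) (hgM _) (hg_nn _)
            (mul_nonneg hC hK0)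
    have h := norm_integral_le_of_norm_le_const hbound
    rw [show s + T - s = T by ring, abs_of_pos hT, Real.norm_eq_abs] at h
    have : I s ≤ C * K * M * T := le_trans (le_abs_self _) h
    rw [e_eq s]
    nlinarith
  by_contra hlt
  push Not at hlt
  set θ := 2 * C * M * T with hθ
  have hθ0 : 0 ≤ θ := by rw [hθ]; positivity
  obtain ⟨s₀, hs₀⟩ := hpos
  have hB0 : 0 < B := lt_of_lt_of_le hs₀ (heB s₀)
  have hiter : ∀ n : ℕ, ∀ s, e s ≤ θ ^ n * B := by
    intro n
    induction n with
    | zero => intro s; simpa using heB s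
    | succ n ih =>
      intro s
      have := hstep _ ih s
      calc e s ≤ θ * (θ ^ n * B) := this
        _ = θ ^ (n + 1) * B := by rw [pow_succ]; ring
  obtain ⟨n, hn⟩ := exists_pow_lt_of_lt_one (div_pos hs₀ hB0) hlt
  have h1 : θ ^ n * B < e s₀ := by
    have := (lt_div_iff₀ hB0).mp hn
    linarith
  linarith [hiter n s₀]

end LagAction

section LagActionProfiles

variable {V : Type*} [NormedAddCommGroup V] [InnerProductSpace ℝ V]
variable {ρ : Type*} [Fintype ρ]

/-- **Lag-action lower bound.**  A nontrivial profile family of the `λ = 1` lattice of an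
S-table with leading decay (`Φ_r → 0` at `−∞`) and mass bound `M` has `2 C_A M T ≥ 1`.
(Model statement about lattice ODEs; nothing here is a claim about Navier–Stokes.)
[cite: Tao2016AveragedNS, §4 Lemma 4.1 (4.8)–(4.9) with (4.3) (the lattice energy/flux structure the profile system abstracts); cell theorem of harvest/h2-tao-ladder (theory-2 g10, kernel file ThmA_quant.lean v3.1 46d34f6681f7f677, referee c32)] -/
theorem IsSWave.lag_action_lower_bound {π : Equiv.Perm ρ} {Q A : V → V} {B : V → V → V}
    {CA T : ℝ} (hS : STable Q A B CA) (hT : 0 < T) {Φ : ρ → ℝ → V}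
    (hΦ : IsSWave π Q A B 0 1 1 T Φ) {M : ℝ} (hM : ∀ x, sMass Φ x ≤ M)
    (lead : ∀ r, Tendsto (Φ r) atBot (𝓝 0)) (hne : ∃ r x, Φ r x ≠ 0) :
    1 ≤ 2 * CA * M * T := by
  have hM0 : 0 ≤ M := le_trans (sMass_nonneg Φ 0) (hM 0)
  have hCA := hS.CA_nonneg
  have hderiv : ∀ x, HasDerivAt (sEnergy Φ)
      (2 * (sFlux π A T Φ (x + T) - sFlux π A T Φ x)) x := by
    intro x
    refine (hasDerivAt_sEnergy hS hΦ x).congr_deriv ?_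
    ring
  have hflux : ∀ σ, |sFlux π A T Φ σ| ≤ CA * sEnergy Φ σ * sMass Φ (σ - T) :=
    fun σ => abs_sFlux_le hS π T Φ σ
  have heB : ∀ x, sEnergy Φ x ≤ M ^ 2 := fun x =>
    le_trans (sEnergy_le_sMass_sq Φ x) (pow_le_pow_left₀ (sMass_nonneg Φ x) (hM x) 2)
  have he_bot : Tendsto (sEnergy Φ) atBot (𝓝 0) := by
    have h : Tendsto (fun x => ∑ r, ‖Φ r x‖ ^ 2) atBot (𝓝 (∑ _r : ρ, (0:ℝ))) :=
      tendsto_finsetSum _ fun r _ => by simpa using ((lead r).norm).pow 2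
    rw [Finset.sum_const_zero] at h
    exact h
  have hf_bot : Tendsto (sFlux π A T Φ) atBot (𝓝 0) := by
    have hb : Tendsto (fun σ => CA * sEnergy Φ σ * M) atBot (𝓝 0) := by
      simpa using (he_bot.const_mul CA).mul_const M
    refine squeeze_zero_norm (fun σ => ?_) hb
    rw [Real.norm_eq_abs]
    exact le_trans (hflux σ) (mul_le_mul_of_nonneg_left (hM _)
      (mul_nonneg hCA (sEnergy_nonneg Φ σ)))
  have hpos : ∃ s, 0 < sEnergy Φ s := by
    obtain ⟨r, x, hrx⟩ := hne
    refine ⟨x, lt_of_lt_of_le (by positivity : 0 < ‖Φ r x‖ ^ 2) ?_⟩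
    unfold sEnergy
    exact Finset.single_le_sum (fun i _ => sq_nonneg ‖Φ i x‖) (Finset.mem_univ r)
  exact lag_action_lower_bound_of_wave_identity hT hCA hM0 (hΦ.continuous_sFlux hS)
    (sEnergy_nonneg Φ) (sMass_nonneg Φ) hderiv hflux hM heB he_bot hf_bot hpos

end LagActionProfiles

/-! ## Part 6.  THEOREM B′-lag (theory-2 g10): a LAG-DATA weighted floor for exact
discretely self-similar fronts (damping `d > 0`, ANY real feed/drain `c₁, c₂`; e.g. the
`λ`-lattice in renormalised variables, `c₁ = λ^{5/2} e^{-2dT}`-weighted, `c₂ = λ^{-5/2}`)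

NOMENCLATURE (v3.1): the TREE's THEOREM B′ is `IsSWave.weighted_sEnergy_le` /
`IsSWave.exp_neg_action_mul_le_residue` (Literature …Tao2016AveragedNS.SelfSimilarCascadeResidues,
theory-2 g5): the RELATIVE bound `Ẽ ≤ e^{H} · lim Ẽ` with the TOTAL action
`H = 2 C_A (|c₁|e^{−2dT} + |c₂|) ∫ sMass`, under the hypothesis `Integrable (sMass Φ)`; and the
tree's THEOREM B″ is `IsDSSWave.width_lower_bound`.  The theorem below is a DIFFERENT, weaker-shaped
statement and is therefore called B′-lag: it assumes NO integrability of the mass (trailing tail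
integrability is derived from `d > 0` and eventual boundedness) and its constants are LAG DATA
(`M = sup sMass`, the delay `T`) as in THEOREM A′, at the price of an ABSOLUTE floor `∝ d²`
instead of a relative one.  Theorem B says: zero weighted residue (`e^{dx} Φ_r → 0`) forces
`Φ ≡ 0`.  B′-lag: with
`Ẽ(x) := e^{2dx} sEnergy Φ x` eventually `≤ L` (a weighted residue level), `sMass ≤ M`,
`κ := |c₁| e^{−2dT} + |c₂|` and `Λ' := exp(2 |c₂| C_A M T)`: EITHER `Ẽ ≤ 3 L Λ'` everywhere
(no front above its residue level), OR for every phase `x` with `Ẽ(x) > 3 L Λ'`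
(a front at phase `x`) the residue measured from that phase obeys
`d² ≤ 48 q κ² C_A² Λ' · (L e^{−2dx})`, i.e. `lim sup_{y→∞} e^{2d(y−x)} E(y) ≥ d² e^{−2|c₂|C_A M T}/(48 q κ² C_A²)`.
Mechanism = Part 4 with the tail-mass integral `Γ(u) = ∫_u^∞ sMass` in place of the pointwise
lag-ahead mass (the lopsided identity does not telescope): PLATEAU′ (monotonicity of
`Ẽ − 2C K(|c₁|Γ + |c₂|Γ(·−T))`), THRESHOLD′ (IVT on the antitone `Γ`: `4κC Γ(a) = 1`),
GAP′ (comparison function `(Ẽ − 2|c₁|C E₊ Γ + β) e^{λu}`), and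
`Γ(a) ≤ √(qK) e^{−da}/d` wherever `Ẽ ≤ K` on `[a, ∞)`.  MODEL statement; nothing about NS. -/

section QuantB

/-- **Plateau′.**  Lopsided identity, `e ≤ K` on `[s₁, ∞)`, eventually `e ≤ L`, tail-mass
majorant `Γ` (`Γ' = −g`, `Γ ≥ 0`) with `4 κ C Γ(s₁ − T) ≤ 1` ⇒ `e ≤ 2L` on `[s₁, ∞)`.
[cite: Tao2016AveragedNS, §4 Lemma 4.1 (4.8)–(4.9) with (4.3) (the lattice energy/flux structure the profile system abstracts); cell theorem of harvest/h2-tao-ladder (theory-2 g10, kernel file ThmA_quant.lean v3.1 46d34f6681f7f677, referee c32)] -/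
theorem plateau_weighted {e f g Γ : ℝ → ℝ} {T C c₁ c₂ L B s₁ : ℝ} (hT : 0 < T) (hC : 0 ≤ C)
    (he_nn : ∀ s, 0 ≤ e s) (hg_nn : ∀ s, 0 ≤ g s)
    (hderiv : ∀ s, HasDerivAt e (2 * (c₁ * f (s + T) - c₂ * f s)) s)
    (hflux : ∀ σ, |f σ| ≤ C * e σ * g (σ - T))
    (hΓd : ∀ u, HasDerivAt Γ (-(g u)) u) (hΓnn : ∀ u, 0 ≤ Γ u)
    (hsmall : 4 * (|c₁| + |c₂|) * C * Γ (s₁ - T) ≤ 1)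
    (hB : ∀ s, s₁ ≤ s → e s ≤ B) (hev : ∃ S₀, ∀ S, S₀ ≤ S → e S ≤ L) :
    ∀ s, s₁ ≤ s → e s ≤ 2 * L := by
  obtain ⟨S₀, hS₀⟩ := hev
  have hΓanti : Antitone Γ :=
    antitone_of_hasDerivAt_nonpos (f' := fun u => -(g u)) (fun u => hΓd u)
      (fun u => by show -(g u) ≤ 0; linarith [hg_nn u])
  -- one step: e ≤ K on [s₁,∞) ⇒ e ≤ L + K/2 there
  have hstep : ∀ K, (∀ s, s₁ ≤ s → e s ≤ K) → ∀ s, s₁ ≤ s → e s ≤ L + K / 2 := by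
    intro K hK s hs
    have hK0 : 0 ≤ K := le_trans (he_nn s₁) (hK s₁ le_rfl)
    -- χ(u) := e u − 2 C K (|c₁| Γ u + |c₂| Γ (u − T)) is monotone on [s₁, ∞)
    set χ : ℝ → ℝ := fun u => e u - 2 * C * K * (|c₁| * Γ u + |c₂| * Γ (u - T)) with hχ
    have hderivχ : ∀ u, HasDerivAt χ
        (2 * (c₁ * f (u + T) - c₂ * f u) - 2 * C * K * (|c₁| * (-(g u)) + |c₂| * (-(g (u - T))))) u := by
      intro u
      have h1 : HasDerivAt (fun u => Γ (u - T)) (-(g (u - T))) u :=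
        HasDerivAt.comp_sub_const u T (hΓd (u - T))
      have h2 : HasDerivAt (fun u => |c₁| * Γ u + |c₂| * Γ (u - T))
          (|c₁| * (-(g u)) + |c₂| * (-(g (u - T)))) u :=
        ((hΓd u).const_mul |c₁|).add (h1.const_mul |c₂|)
      exact (hderiv u).sub (h2.const_mul (2 * C * K))
    have hnonneg : ∀ u, s₁ ≤ u →
        0 ≤ 2 * (c₁ * f (u + T) - c₂ * f u)
          - 2 * C * K * (|c₁| * (-(g u)) + |c₂| * (-(g (u - T)))) := by
      intro u hu
      have hf1 : |f (u + T)| ≤ C * K * g u := by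
        calc |f (u + T)| ≤ C * e (u + T) * g (u + T - T) := hflux (u + T)
          _ = C * e (u + T) * g u := by rw [add_sub_cancel_right]
          _ ≤ C * K * g u := mul_le_mul_of_nonneg_right
              (mul_le_mul_of_nonneg_left (hK (u + T) (by linarith)) hC) (hg_nn u)
      have hf2 : |f u| ≤ C * K * g (u - T) := by
        calc |f u| ≤ C * e u * g (u - T) := hflux u
          _ ≤ C * K * g (u - T) := mul_le_mul_of_nonneg_right
              (mul_le_mul_of_nonneg_left (hK u hu) hC) (hg_nn _)
      have h1 : |c₁ * f (u + T)| ≤ |c₁| * (C * K * g u) := by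
        rw [abs_mul]; exact mul_le_mul_of_nonneg_left hf1 (abs_nonneg _)
      have h2 : |c₂ * f u| ≤ |c₂| * (C * K * g (u - T)) := by
        rw [abs_mul]; exact mul_le_mul_of_nonneg_left hf2 (abs_nonneg _)
      have h1' := abs_le.mp h1
      have h2' := abs_le.mp h2
      nlinarith [h1'.1, h2'.2]
    have hmono : MonotoneOn χ (Ici s₁) :=
      monotoneOn_of_hasDerivWithinAt_nonneg (convex_Ici s₁)
        (HasDerivAt.continuousOn fun u _ => hderivχ u)
        (fun u _ => (hderivχ u).hasDerivWithinAt)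
        (fun u hu => by
          rw [interior_Ici] at hu
          exact hnonneg u (le_of_lt hu))
    set S := max s S₀ with hSdef
    have hsS : s ≤ S := le_max_left _ _
    have hχle : χ s ≤ χ S := hmono (show s ∈ Ici s₁ from hs) (show S ∈ Ici s₁ from le_trans hs hsS) hsS
    have heS : e S ≤ L := hS₀ S (le_max_right _ _)
    have hΓ1 : Γ s ≤ Γ (s₁ - T) := hΓanti (by linarith)
    have hΓ2 : Γ (s - T) ≤ Γ (s₁ - T) := hΓanti (by linarith)
    have hΓ3 := hΓnn S
    have hΓ4 := hΓnn (S - T)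
    have hc1 := abs_nonneg c₁
    have hc2 := abs_nonneg c₂
    -- χ s ≤ χ S unfolds to the plateau inequality
    have key : e s ≤ e S + 2 * C * K * ((|c₁| + |c₂|) * Γ (s₁ - T)) := by
      have := hχle
      simp only [hχ] at this
      nlinarith [mul_nonneg (mul_nonneg (mul_nonneg (by norm_num : (0:ℝ) ≤ 2) hC) hK0) hc1,
        mul_nonneg (mul_nonneg (mul_nonneg (by norm_num : (0:ℝ) ≤ 2) hC) hK0) hc2,
        mul_le_mul_of_nonneg_left hΓ1 hc1, mul_le_mul_of_nonneg_left hΓ2 hc2]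
    have h4 : 2 * C * K * ((|c₁| + |c₂|) * Γ (s₁ - T)) ≤ K / 2 := by
      have : 2 * C * ((|c₁| + |c₂|) * Γ (s₁ - T)) ≤ 1 / 2 := by nlinarith [hsmall]
      nlinarith [this, hK0]
    linarith
  -- iterate as in Part 4
  have hB0 : 0 ≤ B := le_trans (he_nn s₁) (hB s₁ le_rfl)
  have hL0 : 0 ≤ L := le_trans (he_nn _) (hS₀ (max s₁ S₀) (le_max_right _ _))
  have hiter : ∀ n : ℕ, ∀ s, s₁ ≤ s → e s ≤ 2 * L + B / 2 ^ n := by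
    intro n
    induction n with
    | zero => intro s hs; have := hB s hs; simp only [pow_zero, div_one]; linarith
    | succ n ih =>
      intro s hs
      have := hstep _ ih s hs
      have h2 : L + (2 * L + B / 2 ^ n) / 2 = 2 * L + B / 2 ^ (n + 1) := by
        rw [pow_succ]; ring
      linarith [h2]
  intro s hs
  refine le_of_forall_pos_le_add fun ε hε => ?_
  rcases eq_or_lt_of_le hB0 with hB' | hBpos
  · have := hiter 0 s hs
    rw [← hB'] at this
    simp only [pow_zero, div_one, add_zero] at this
    linarith
  · obtain ⟨n, hn⟩ := exists_pow_lt_of_lt_one (div_pos hε hBpos) (by norm_num : (1:ℝ) / 2 < 1)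
    have h1 : B / 2 ^ n = B * (1 / 2) ^ n := by rw [one_div, inv_pow, div_eq_mul_inv]
    have h2 : B * (1 / 2) ^ n < ε := by
      have := (lt_div_iff₀ hBpos).mp hn
      linarith [this]
    have := hiter n s hs
    rw [h1] at this
    linarith

/-- **Gap′** (one backward comparison step over a lag, lopsided identity).
[cite: Tao2016AveragedNS, §4 Lemma 4.1 (4.8)–(4.9) with (4.3) (the lattice energy/flux structure the profile system abstracts); cell theorem of harvest/h2-tao-ladder (theory-2 g10, kernel file ThmA_quant.lean v3.1 46d34f6681f7f677, referee c32)] -/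
theorem gap_weighted {e f g Γ : ℝ → ℝ} {T C c₁ c₂ M Ep a : ℝ} (hT : 0 < T) (hC : 0 ≤ C)
    (hM : 0 ≤ M) (hE : 0 ≤ Ep) (he_cont : Continuous e) (he_nn : ∀ s, 0 ≤ e s)
    (hg_nn : ∀ s, 0 ≤ g s)
    (hderiv : ∀ s, HasDerivAt e (2 * (c₁ * f (s + T) - c₂ * f s)) s)
    (hflux : ∀ σ, |f σ| ≤ C * e σ * g (σ - T)) (hgM : ∀ u, g u ≤ M)
    (hΓd : ∀ u, HasDerivAt Γ (-(g u)) u) (hΓnn : ∀ u, 0 ≤ Γ u)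
    (hβ : 2 * |c₁| * C * Γ a ≤ 1 / 2) (hplat : ∀ s, a + T ≤ s → e s ≤ Ep) :
    ∀ u, a ≤ u → u ≤ a + T → e u ≤ 3 / 2 * Ep * Real.exp (2 * |c₂| * C * M * T) := by
  intro u hau huT
  have hΓanti : Antitone Γ :=
    antitone_of_hasDerivAt_nonpos (f' := fun u => -(g u)) (fun u => hΓd u)
      (fun u => by show -(g u) ≤ 0; linarith [hg_nn u])
  set lam := 2 * |c₂| * C * M with hlam
  have hlam0 : 0 ≤ lam := by rw [hlam]; positivity
  set β := 2 * |c₁| * C * Ep * Γ a with hβdef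
  have hβ0 : 0 ≤ β := by rw [hβdef]; have := hΓnn a; positivity
  have hβle : β ≤ Ep / 2 := by
    rw [hβdef]
    have : 2 * |c₁| * C * Ep * Γ a = Ep * (2 * |c₁| * C * Γ a) := by ring
    rw [this]; nlinarith [hβ, hE]
  -- ψ(x) := (e x − 2|c₁| C Ep Γ x + β) * exp(lam x)
  set ψ : ℝ → ℝ := fun x => (e x - 2 * |c₁| * C * Ep * Γ x + β) * Real.exp (lam * x) with hψ
  have hderivψ : ∀ x, HasDerivAt ψ
      ((2 * (c₁ * f (x + T) - c₂ * f x) - 2 * |c₁| * C * Ep * (-(g x))) * Real.exp (lam * x)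
        + (e x - 2 * |c₁| * C * Ep * Γ x + β) * (Real.exp (lam * x) * lam)) x := by
    intro x
    have h1 : HasDerivAt (fun x => e x - 2 * |c₁| * C * Ep * Γ x + β)
        (2 * (c₁ * f (x + T) - c₂ * f x) - 2 * |c₁| * C * Ep * (-(g x))) x :=
      ((hderiv x).sub ((hΓd x).const_mul _)).add_const β
    have h2 : HasDerivAt (fun x => Real.exp (lam * x)) (Real.exp (lam * x) * lam) x := by
      have : HasDerivAt (fun x => lam * x) lam x := by
        simpa using (hasDerivAt_id x).const_mul lam
      simpa using this.exp
    exact h1.mul h2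
  have hnonneg : ∀ x, a ≤ x → x ≤ a + T →
      0 ≤ (2 * (c₁ * f (x + T) - c₂ * f x) - 2 * |c₁| * C * Ep * (-(g x))) * Real.exp (lam * x)
        + (e x - 2 * |c₁| * C * Ep * Γ x + β) * (Real.exp (lam * x) * lam) := by
    intro x hax _hxT
    have hex := Real.exp_pos (lam * x)
    have hf1 : |f (x + T)| ≤ C * Ep * g x := by
      calc |f (x + T)| ≤ C * e (x + T) * g (x + T - T) := hflux (x + T)
        _ = C * e (x + T) * g x := by rw [add_sub_cancel_right]
        _ ≤ C * Ep * g x := mul_le_mul_of_nonneg_right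
            (mul_le_mul_of_nonneg_left (hplat (x + T) (by linarith)) hC) (hg_nn x)
    have hf2 : |f x| ≤ C * e x * M := by
      calc |f x| ≤ C * e x * g (x - T) := hflux x
        _ ≤ C * e x * M := mul_le_mul_of_nonneg_left (hgM _) (mul_nonneg hC (he_nn x))
    have h1 : |c₁ * f (x + T)| ≤ |c₁| * (C * Ep * g x) := by
      rw [abs_mul]; exact mul_le_mul_of_nonneg_left hf1 (abs_nonneg _)
    have h2 : |c₂ * f x| ≤ |c₂| * (C * e x * M) := by
      rw [abs_mul]; exact mul_le_mul_of_nonneg_left hf2 (abs_nonneg _)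
    have h1' := abs_le.mp h1
    have h2' := abs_le.mp h2
    -- derivative of the first factor ≥ -lam * e x ≥ -lam * (e x - 2|c₁|C Ep Γ x + β)
    have hΓx : 2 * |c₁| * C * Ep * Γ x ≤ β := by
      rw [hβdef]
      exact mul_le_mul_of_nonneg_left (hΓanti hax) (by positivity)
    have key : -(lam * (e x - 2 * |c₁| * C * Ep * Γ x + β))
        ≤ 2 * (c₁ * f (x + T) - c₂ * f x) - 2 * |c₁| * C * Ep * (-(g x)) := by
      have hA : -(lam * e x) ≤ 2 * (c₁ * f (x + T) - c₂ * f x) - 2 * |c₁| * C * Ep * (-(g x)) := by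
        rw [hlam]; nlinarith [h1'.1, h2'.2]
      have hB : lam * e x ≤ lam * (e x - 2 * |c₁| * C * Ep * Γ x + β) :=
        mul_le_mul_of_nonneg_left (by linarith) hlam0
      linarith
    have h := mul_le_mul_of_nonneg_right key hex.le
    have hid : (e x - 2 * |c₁| * C * Ep * Γ x + β) * (Real.exp (lam * x) * lam)
        = lam * (e x - 2 * |c₁| * C * Ep * Γ x + β) * Real.exp (lam * x) := by ring
    rw [hid]
    linarith
  have hΓcont : Continuous Γ := continuous_iff_continuousAt.mpr fun u => (hΓd u).continuousAt
  have hcontψ : Continuous ψ := by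
    have h1 : Continuous fun x => Real.exp (lam * x) :=
      Real.continuous_exp.comp (continuous_const.mul continuous_id)
    exact (((he_cont.sub (continuous_const.mul hΓcont)).add continuous_const)).mul h1
  have hmono : MonotoneOn ψ (Icc a (a + T)) :=
    monotoneOn_of_hasDerivWithinAt_nonneg (convex_Icc a (a + T)) hcontψ.continuousOn
      (fun x _ => (hderivψ x).hasDerivWithinAt)
      (fun x hx => by
        rw [interior_Icc] at hx
        exact hnonneg x hx.1.le hx.2.le)
  have hψle : ψ u ≤ ψ (a + T) := hmono ⟨hau, huT⟩ ⟨by linarith, le_rfl⟩ huT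
  have hsplit : Real.exp (lam * (a + T)) = Real.exp (lam * u) * Real.exp (lam * (a + T - u)) := by
    rw [← Real.exp_add]; congr 1; ring
  have hpos := Real.exp_pos (lam * u)
  have hΓaT : 0 ≤ 2 * |c₁| * C * Ep * Γ (a + T) := by have := hΓnn (a + T); positivity
  have hψ' : (e u - 2 * |c₁| * C * Ep * Γ u + β) * Real.exp (lam * u)
      ≤ ((Ep + β) * Real.exp (lam * (a + T - u))) * Real.exp (lam * u) := by
    calc (e u - 2 * |c₁| * C * Ep * Γ u + β) * Real.exp (lam * u) = ψ u := rfl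
      _ ≤ ψ (a + T) := hψle
      _ = (e (a + T) - 2 * |c₁| * C * Ep * Γ (a + T) + β) * Real.exp (lam * (a + T)) := rfl
      _ ≤ (Ep + β) * Real.exp (lam * (a + T)) :=
          mul_le_mul_of_nonneg_right (by linarith [hplat (a + T) le_rfl]) (Real.exp_pos _).le
      _ = ((Ep + β) * Real.exp (lam * (a + T - u))) * Real.exp (lam * u) := by
          rw [hsplit]; ring
  have h3 : e u - 2 * |c₁| * C * Ep * Γ u + β ≤ (Ep + β) * Real.exp (lam * (a + T - u)) :=
    le_of_mul_le_mul_right hψ' hpos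
  have hexp_le : Real.exp (lam * (a + T - u)) ≤ Real.exp (lam * T) := by
    apply Real.exp_le_exp.mpr
    have : a + T - u ≤ T := by linarith
    exact mul_le_mul_of_nonneg_left this hlam0
  have h4 : (Ep + β) * Real.exp (lam * (a + T - u)) ≤ (Ep + β) * Real.exp (lam * T) :=
    mul_le_mul_of_nonneg_left hexp_le (by positivity)
  have hΓu : 2 * |c₁| * C * Ep * Γ u ≤ β := by
    rw [hβdef]; exact mul_le_mul_of_nonneg_left (hΓanti hau) (by positivity)
  have hE1 : 1 ≤ Real.exp (lam * T) := Real.one_le_exp (by positivity)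
  have : e u ≤ (Ep + β) * Real.exp (lam * T) := by linarith
  have h5 : (Ep + β) * Real.exp (lam * T) ≤ (3 / 2 * Ep) * Real.exp (lam * T) :=
    mul_le_mul_of_nonneg_right (by linarith) (Real.exp_pos _).le
  rw [hlam] at h5 this
  have h6 : (3 / 2 * Ep) * Real.exp (2 * |c₂| * C * M * T) = 3 / 2 * Ep * Real.exp (2 * |c₂| * C * M * T) := by ring
  linarith [h5, h6]

/-- **THEOREM B′-lag — scalar core (quantitative weighted floor from lag data).**  See the Part 6 docstring.
`Γ` is a tail-mass majorant with `Γ' = −g`, `Γ ≥ 0` and the exponential envelope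
`Γ a ≤ √(qK) e^{−da}/d` wherever `e ≤ K` on `[a, ∞)`.
[cite: Tao2016AveragedNS, §4 Lemma 4.1 (4.8)–(4.9) with (4.3) (the lattice energy/flux structure the profile system abstracts); cell theorem of harvest/h2-tao-ladder (theory-2 g10, kernel file ThmA_quant.lean v3.1 46d34f6681f7f677, referee c32)] -/
theorem weighted_trailing_floor
    {e f g Γ : ℝ → ℝ} {T C c₁ c₂ d q M L : ℝ} (hT : 0 < T) (hC : 0 ≤ C) (hd : 0 < d)
    (hq : 0 ≤ q) (hM : 0 ≤ M) (hL : 0 ≤ L)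
    (he_cont : Continuous e)
    (he_nn : ∀ s, 0 ≤ e s) (hg_nn : ∀ s, 0 ≤ g s)
    (hderiv : ∀ s, HasDerivAt e (2 * (c₁ * f (s + T) - c₂ * f s)) s)
    (hflux : ∀ σ, |f σ| ≤ C * e σ * g (σ - T)) (hgM : ∀ s, g s ≤ M)
    (hΓd : ∀ u, HasDerivAt Γ (-(g u)) u) (hΓnn : ∀ u, 0 ≤ Γ u)
    (hΓle : ∀ a K, 0 ≤ K → (∀ v, a ≤ v → e v ≤ K) →
      Γ a ≤ Real.sqrt (q * K) * Real.exp (-(d * a)) / d)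
    (hev : ∃ S₀, ∀ S, S₀ ≤ S → e S ≤ L) :
    (∀ s, e s ≤ 3 * L * Real.exp (2 * |c₂| * C * M * T)) ∨
      (∀ x, 3 * L * Real.exp (2 * |c₂| * C * M * T) < e x →
        d ^ 2 ≤ 48 * q * (|c₁| + |c₂|) ^ 2 * C ^ 2 * Real.exp (2 * |c₂| * C * M * T)
          * (L * Real.exp (-(2 * d * x)))) := by
  obtain ⟨S₀, hS₀⟩ := hev
  set κ := |c₁| + |c₂| with hκ
  set Λ' := Real.exp (2 * |c₂| * C * M * T) with hΛ'
  have hκ0 : 0 ≤ κ := by rw [hκ]; positivity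
  have hΛ1 : 1 ≤ Λ' := Real.one_le_exp (by positivity)
  have hΓanti : Antitone Γ :=
    antitone_of_hasDerivAt_nonpos (f' := fun u => -(g u)) (fun u => hΓd u)
      (fun u => by show -(g u) ≤ 0; linarith [hg_nn u])
  have hΓcont : Continuous Γ := continuous_iff_continuousAt.mpr fun u => (hΓd u).continuousAt
  -- boundedness of e on half-lines
  have hbd : ∀ s₁, ∃ B, ∀ s, s₁ ≤ s → e s ≤ B := by
    intro s₁
    obtain ⟨x₀, _, hx₀⟩ := (isCompact_Icc (a := s₁) (b := max s₁ S₀)).exists_isMaxOn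
      (nonempty_Icc.mpr (le_max_left _ _)) he_cont.continuousOn
    refine ⟨max (e x₀) L, fun s hs => ?_⟩
    by_cases h : s ≤ max s₁ S₀
    · exact le_trans (hx₀ ⟨hs, h⟩) (le_max_left _ _)
    · push Not at h
      exact le_trans (hS₀ s (le_trans (le_max_right _ _) h.le)) (le_max_right _ _)
  have hplateau : ∀ s₁, 4 * κ * C * Γ (s₁ - T) ≤ 1 → ∀ s, s₁ ≤ s → e s ≤ 2 * L := by
    intro s₁ hsm
    obtain ⟨B, hB⟩ := hbd s₁
    exact plateau_weighted hT hC he_nn hg_nn hderiv hflux hΓd hΓnn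
      (by rw [hκ] at hsm; exact hsm) hB ⟨S₀, hS₀⟩
  by_cases hall : ∀ u, 4 * κ * C * Γ u ≤ 1
  · left
    intro s
    have := hplateau s (hall (s - T)) s le_rfl
    nlinarith [hΛ1, hL]
  right
  push Not at hall
  obtain ⟨u₀, hu₀⟩ := hall
  have hκC : 0 < κ * C := by
    have hΓ0 := hΓnn u₀
    by_contra hnot
    push Not at hnot
    have : κ * C = 0 := le_antisymm hnot (by positivity)
    have hKC : κ * C = 0 := this
    have h4 : 4 * κ * C * Γ u₀ = 4 * (κ * C) * Γ u₀ := by ring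
    rw [h4, hKC] at hu₀
    linarith
  -- a point u₁ ≥ max u₀ S₀ with 4 κ C Γ u₁ ≤ 1 (exponential envelope on [S₀, ∞))
  have henv : ∀ u, S₀ ≤ u → Γ u ≤ Real.sqrt (q * L) * Real.exp (-(d * u)) / d :=
    fun u hu => hΓle u L hL (fun v hv => hS₀ v (le_trans hu hv))
  obtain ⟨u₁, hu₁u₀, hu₁⟩ : ∃ u₁, u₀ ≤ u₁ ∧ 4 * κ * C * Γ u₁ ≤ 1 := by
    have hlim : Tendsto (fun u => 4 * κ * C * (Real.sqrt (q * L) * Real.exp (-(d * u)) / d))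
        atTop (𝓝 (4 * κ * C * (Real.sqrt (q * L) * 0 / d))) := by
      have h1 : Tendsto (fun u => Real.exp (-(d * u))) atTop (𝓝 0) := by
        have : Tendsto (fun u => -(d * u)) atTop atBot :=
          tendsto_neg_atTop_atBot.comp (tendsto_id.const_mul_atTop hd)
        exact Real.tendsto_exp_atBot.comp this
      exact ((h1.const_mul _).div_const _).const_mul _
    rw [mul_zero, zero_div, mul_zero] at hlim
    obtain ⟨N, hN⟩ := (Metric.tendsto_atTop.mp hlim) 1 one_pos
    refine ⟨max (max u₀ S₀) N, le_trans (le_max_left _ _) (le_max_left _ _), ?_⟩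
    have hN' := hN (max (max u₀ S₀) N) (le_max_right _ _)
    rw [dist_zero_right, Real.norm_eq_abs] at hN'
    have h2 := henv (max (max u₀ S₀) N) (le_trans (le_max_right _ _) (le_max_left _ _))
    have h3 : 4 * κ * C * Γ (max (max u₀ S₀) N)
        ≤ 4 * κ * C * (Real.sqrt (q * L) * Real.exp (-(d * max (max u₀ S₀) N)) / d) :=
      mul_le_mul_of_nonneg_left h2 (by positivity)
    linarith [(abs_lt.mp hN').2]
  -- threshold by IVT on [u₀, u₁]
  obtain ⟨a, ha_mem, ha⟩ : ∃ a ∈ Icc u₀ u₁, 4 * κ * C * Γ a = 1 := by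
    have hcont : ContinuousOn (fun u => 4 * κ * C * Γ u) (Icc u₀ u₁) :=
      (continuous_const.mul hΓcont).continuousOn
    have := intermediate_value_Icc' hu₁u₀ hcont ⟨hu₁, hu₀.le⟩
    obtain ⟨a, ha, hfa⟩ := this
    exact ⟨a, ha, hfa⟩
  have h4κC : (4 * κ * C) ≠ 0 := ne_of_gt (by linarith [hκC])
  have hΓa : Γ a = 1 / (4 * κ * C) := by
    rw [eq_div_iff h4κC]; linarith [ha]
  -- plateau on [a+T, ∞), gap on [a, a+T]
  have hplat : ∀ s, a + T ≤ s → e s ≤ 2 * L :=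
    hplateau (a + T) (by rw [add_sub_cancel_right]; exact ha.le)
  have hβ : 2 * |c₁| * C * Γ a ≤ 1 / 2 := by
    have h1 : 2 * |c₁| * C * Γ a ≤ 2 * κ * C * Γ a := by
      have : |c₁| ≤ κ := by rw [hκ]; linarith [abs_nonneg c₂]
      have hΓ0 := hΓnn a
      nlinarith [mul_nonneg hC hΓ0]
    linarith
  have hgap := gap_weighted hT hC hM (by positivity : (0:ℝ) ≤ 2 * L) he_cont he_nn hg_nn
    hderiv hflux hgM hΓd hΓnn hβ hplat
  -- e ≤ 3 L Λ' on [a, ∞)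
  have hKa : ∀ v, a ≤ v → e v ≤ 3 * L * Λ' := by
    intro v hv
    by_cases hvT : v ≤ a + T
    · have := hgap v hv hvT
      have h6 : 3 / 2 * (2 * L) * Real.exp (2 * |c₂| * C * M * T) = 3 * L * Λ' := by rw [hΛ']; ring
      linarith
    · push Not at hvT
      have := hplat v hvT.le
      nlinarith [hΛ1, hL]
  -- envelope at a: 1/(4κC) = Γ a ≤ √(q · 3LΛ') e^{-da} / d
  have hK0 : 0 ≤ 3 * L * Λ' := by positivity
  have henv_a := hΓle a (3 * L * Λ') hK0 hKa
  intro x hx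
  -- x < a
  have hxa : x < a := by
    by_contra hnot
    push Not at hnot
    linarith [hKa x hnot]
  -- d ≤ 4 κ C √(q 3LΛ') e^{-da}
  have h1 : d ≤ 4 * κ * C * (Real.sqrt (q * (3 * L * Λ')) * Real.exp (-(d * a))) := by
    -- Γ a * d ≤ √… e^{-da}
    have h0 : Γ a * d ≤ Real.sqrt (q * (3 * L * Λ')) * Real.exp (-(d * a)) := by
      have := (le_div_iff₀ hd).mp henv_a
      linarith
    have h0' := mul_le_mul_of_nonneg_left h0 (by positivity : (0:ℝ) ≤ 4 * κ * C)
    have hid : 4 * κ * C * (Γ a * d) = d := by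
      rw [hΓa, one_div, ← mul_assoc, mul_inv_cancel₀ h4κC, one_mul]
    linarith [h0', hid]
  have h2 : d ^ 2 ≤ (4 * κ * C * (Real.sqrt (q * (3 * L * Λ')) * Real.exp (-(d * a)))) ^ 2 :=
    pow_le_pow_left₀ hd.le h1 2
  have hsq : Real.sqrt (q * (3 * L * Λ')) ^ 2 = q * (3 * L * Λ') :=
    Real.sq_sqrt (by positivity)
  have hexp2 : Real.exp (-(d * a)) ^ 2 = Real.exp (-(2 * d * a)) := by
    rw [sq, ← Real.exp_add]; congr 1; ring
  have h3 : (4 * κ * C * (Real.sqrt (q * (3 * L * Λ')) * Real.exp (-(d * a)))) ^ 2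
      = 48 * q * κ ^ 2 * C ^ 2 * Λ' * (L * Real.exp (-(2 * d * a))) := by
    simp only [mul_pow, hsq, hexp2]; ring
  rw [h3] at h2
  -- e^{-2da} ≤ e^{-2dx} since x < a
  have h4 : Real.exp (-(2 * d * a)) ≤ Real.exp (-(2 * d * x)) :=
    Real.exp_le_exp.mpr (by nlinarith [hxa, hd])
  have h5 : 48 * q * κ ^ 2 * C ^ 2 * Λ' * (L * Real.exp (-(2 * d * a)))
      ≤ 48 * q * κ ^ 2 * C ^ 2 * Λ' * (L * Real.exp (-(2 * d * x))) :=
    mul_le_mul_of_nonneg_left (mul_le_mul_of_nonneg_left h4 hL) (by positivity)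
  exact le_trans h2 h5

end QuantB

section QuantBProfiles

variable {V : Type*} [NormedAddCommGroup V] [InnerProductSpace ℝ V]
variable {ρ : Type*} [Fintype ρ]

/-- **THEOREM B′-lag (profile version, theory-2 g10; NOT the tree's B′ = `IsSWave.weighted_sEnergy_le`,
which bounds `Ẽ ≤ e^{H} lim Ẽ` by the total action under `Integrable (sMass Φ)`).**  For a renormalised exact front of the
`(d, c₁, c₂, T)`-lattice of an S-table (`d > 0`, mass `≤ M`, weighted energy
`Ẽ(x) = e^{2dx} E(x)` eventually `≤ L`): either `Ẽ ≤ 3 L Λ'` everywhere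
(`Λ' = exp(2|c₂| C_A M T)`), or at every phase `x` where `Ẽ(x) > 3 L Λ'` the weighted residue
measured from `x` is bounded below: `d² ≤ 48 q (|c₁|e^{−2dT} + |c₂|)² C_A² Λ' · L e^{−2dx}`.
[cite: Tao2016AveragedNS, §4 Lemma 4.1 (4.8)–(4.9) with (4.3) (the lattice energy/flux structure the profile system abstracts); cell theorem of harvest/h2-tao-ladder (theory-2 g10, kernel file ThmA_quant.lean v3.1 46d34f6681f7f677, referee c32)] -/
theorem IsSWave.weighted_residue_floor {π : Equiv.Perm ρ} {Q A : V → V} {B : V → V → V}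
    {CA d c₁ c₂ T : ℝ} (hS : STable Q A B CA) (hT : 0 < T) (hd : 0 < d) {Φ : ρ → ℝ → V}
    (hΦ : IsSWave π Q A B d c₁ c₂ T Φ) {M L : ℝ} (hM : ∀ x, sMass Φ x ≤ M) (hL : 0 ≤ L)
    (hev : ∃ S₀, ∀ x, S₀ ≤ x → Real.exp (2 * d * x) * sEnergy Φ x ≤ L) :
    (∀ x, Real.exp (2 * d * x) * sEnergy Φ x ≤ 3 * L * Real.exp (2 * |c₂| * CA * M * T)) ∨
    (∀ x, 3 * L * Real.exp (2 * |c₂| * CA * M * T) < Real.exp (2 * d * x) * sEnergy Φ x →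
      d ^ 2 ≤ 48 * (Fintype.card ρ : ℝ) * (|c₁| * Real.exp (-(2 * d * T)) + |c₂|) ^ 2 * CA ^ 2
        * Real.exp (2 * |c₂| * CA * M * T) * (L * Real.exp (-(2 * d * x)))) := by
  have ce := hΦ.continuous_sEnergy
  have cF := hΦ.continuous_sFlux hS
  have cM := hΦ.continuous_sMass
  have hCA := hS.CA_nonneg
  have hM0 : 0 ≤ M := le_trans (sMass_nonneg Φ 0) (hM 0)
  set q : ℝ := (Fintype.card ρ : ℝ) with hq
  have hq0 : 0 ≤ q := by rw [hq]; positivity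
  obtain ⟨S₀, hS₀⟩ := hev
  -- weighted identity and flux bound (as in Theorem B)
  have hderiv : ∀ x, HasDerivAt (fun x => Real.exp (2 * d * x) * sEnergy Φ x)
      (2 * (c₁ * Real.exp (-(2 * d * T))
        * (Real.exp (2 * d * (x + T)) * sFlux π A T Φ (x + T))
        - c₂ * (Real.exp (2 * d * x) * sFlux π A T Φ x))) x := by
    intro x
    have h1 : HasDerivAt (fun x => Real.exp (2 * d * x)) (Real.exp (2 * d * x) * (2 * d * 1)) x :=
      ((hasDerivAt_id x).const_mul (2 * d)).exp
    refine (h1.mul (hasDerivAt_sEnergy hS hΦ x)).congr_deriv ?_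
    have ex1 : Real.exp (2 * d * (x + T)) = Real.exp (2 * d * x) * Real.exp (2 * d * T) := by
      rw [← Real.exp_add]; congr 1; ring
    have ex2 : Real.exp (-(2 * d * T)) * Real.exp (2 * d * T) = 1 := by
      rw [Real.exp_neg, inv_mul_cancel₀ (Real.exp_pos _).ne']
    rw [ex1]
    linear_combination (-(2 * c₁ * Real.exp (2 * d * x) * sFlux π A T Φ (x + T))) * ex2
  have hflux : ∀ σ, |Real.exp (2 * d * σ) * sFlux π A T Φ σ|
      ≤ CA * (Real.exp (2 * d * σ) * sEnergy Φ σ) * sMass Φ (σ - T) := by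
    intro σ
    rw [abs_mul, abs_of_pos (Real.exp_pos _)]
    calc Real.exp (2 * d * σ) * |sFlux π A T Φ σ|
        ≤ Real.exp (2 * d * σ) * (CA * sEnergy Φ σ * sMass Φ (σ - T)) :=
          mul_le_mul_of_nonneg_left (abs_sFlux_le hS π T Φ σ) (Real.exp_pos _).le
      _ = _ := by ring
  -- pointwise exponential envelope of the mass where the weighted energy is ≤ K
  have henvpt : ∀ K v, 0 ≤ K → Real.exp (2 * d * v) * sEnergy Φ v ≤ K →
      sMass Φ v ≤ Real.sqrt (q * K) * Real.exp (-d * v) := by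
    intro K v hK hv
    have hex := Real.exp_pos (2 * d * v)
    have hE : sEnergy Φ v ≤ K * Real.exp (-(2 * d * v)) := by
      rw [Real.exp_neg, ← div_eq_mul_inv, le_div_iff₀ hex]
      linarith
    have h1 : sMass Φ v ^ 2 ≤ (Real.sqrt (q * K) * Real.exp (-d * v)) ^ 2 := by
      have h2 : Real.exp (-d * v) ^ 2 = Real.exp (-(2 * d * v)) := by
        rw [sq, ← Real.exp_add]; congr 1; ring
      rw [mul_pow, Real.sq_sqrt (by positivity), h2]
      calc sMass Φ v ^ 2 ≤ q * sEnergy Φ v := sMass_sq_le Φ v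
        _ ≤ q * (K * Real.exp (-(2 * d * v))) := mul_le_mul_of_nonneg_left hE hq0
        _ = q * K * Real.exp (-(2 * d * v)) := by ring
    exact (pow_le_pow_iff_left₀ (sMass_nonneg Φ v) (by positivity) two_ne_zero).mp h1
  -- the mass is integrable on every right half-line
  have hint : ∀ a, IntegrableOn (sMass Φ) (Ioi a) := by
    intro a
    set b := max a S₀ with hb
    have hab : a ≤ b := le_max_left _ _
    have h1 : IntegrableOn (sMass Φ) (Ioc a b) := cM.integrableOn_Ioc
    have h2 : IntegrableOn (sMass Φ) (Ioi b) := by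
      have hdom : Integrable (fun v => Real.sqrt (q * L) * Real.exp (-d * v))
          (volume.restrict (Ioi b)) :=
        Integrable.const_mul (exp_neg_integrableOn_Ioi b hd) _
      refine Integrable.mono' hdom cM.aestronglyMeasurable ?_
      refine (ae_restrict_iff' measurableSet_Ioi).mpr (Eventually.of_forall fun v hv => ?_)
      have hbv : b < v := hv
      have hv' : S₀ ≤ v := le_trans (le_max_right a S₀) hbv.le
      rw [Real.norm_eq_abs, abs_of_nonneg (sMass_nonneg Φ _)]
      exact henvpt L v hL (hS₀ v hv')
    rw [← Ioc_union_Ioi_eq_Ioi hab]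
    exact h1.union h2
  -- the tail-mass integral Γ
  set Γ : ℝ → ℝ := fun u => ∫ v in Ioi u, sMass Φ v with hΓ
  have hΓnn : ∀ u, 0 ≤ Γ u := fun u =>
    setIntegral_nonneg measurableSet_Ioi fun v _ => sMass_nonneg Φ v
  have hΓd : ∀ u, HasDerivAt Γ (-(sMass Φ u)) u := by
    intro u
    have hF : HasDerivAt (fun v => ∫ x in (u - 1)..v, sMass Φ x) (sMass Φ u) u :=
      intervalIntegral.integral_hasDerivAt_right (cM.intervalIntegrable _ _)
        (cM.stronglyMeasurableAtFilter _ _) cM.continuousAt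
    have h2 : HasDerivAt (fun v => Γ (u - 1) - ∫ x in (u - 1)..v, sMass Φ x)
        (-(sMass Φ u)) u := hF.const_sub (Γ (u - 1))
    refine h2.congr_of_eventuallyEq ?_
    filter_upwards [Ioi_mem_nhds (show u - 1 < u by linarith)] with v hv
    have := intervalIntegral.integral_Ioi_sub_Ioi (hint (u - 1)) (le_of_lt hv)
    simp only [hΓ]
    linarith
  have hΓle : ∀ a K, 0 ≤ K → (∀ v, a ≤ v → Real.exp (2 * d * v) * sEnergy Φ v ≤ K) →
      Γ a ≤ Real.sqrt (q * K) * Real.exp (-(d * a)) / d := by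
    intro a K hK hKv
    have hdom : IntegrableOn (fun v => Real.sqrt (q * K) * Real.exp (-d * v)) (Ioi a) :=
      Integrable.const_mul (exp_neg_integrableOn_Ioi a hd) _
    have h1 : Γ a ≤ ∫ v in Ioi a, Real.sqrt (q * K) * Real.exp (-d * v) := by
      simp only [hΓ]
      refine setIntegral_mono_on (hint a) hdom measurableSet_Ioi fun v hv => ?_
      exact henvpt K v hK (hKv v (le_of_lt hv))
    have h2 : ∫ v in Ioi a, Real.sqrt (q * K) * Real.exp (-d * v)
        = Real.sqrt (q * K) * Real.exp (-(d * a)) / d := by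
      rw [MeasureTheory.integral_const_mul, integral_exp_mul_Ioi (by linarith : -d < 0) a]
      rw [neg_mul, neg_div_neg_eq]; ring
    linarith [h1, h2]
  -- apply the scalar core
  have core := weighted_trailing_floor
    (e := fun x => Real.exp (2 * d * x) * sEnergy Φ x)
    (f := fun x => Real.exp (2 * d * x) * sFlux π A T Φ x) (g := sMass Φ) (Γ := Γ)
    (c₁ := c₁ * Real.exp (-(2 * d * T))) (c₂ := c₂) (q := q)
    hT hCA hd hq0 hM0 hL (by fun_prop)
    (fun x => mul_nonneg (Real.exp_pos _).le (sEnergy_nonneg Φ x)) (sMass_nonneg Φ)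
    hderiv hflux hM hΓd hΓnn hΓle ⟨S₀, hS₀⟩
  have habs : |c₁ * Real.exp (-(2 * d * T))| = |c₁| * Real.exp (-(2 * d * T)) := by
    rw [abs_mul, abs_of_pos (Real.exp_pos _)]
  rw [habs] at core
  exact core

end QuantBProfiles

end TaoCascade

end Literature.Analysis.FluidPDE
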